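import Literature.Probability.Percolation.TwoPointMoments
import Literature.Barriers.CriticalPhenomena.GaussianDominationRouteContinuity
import HarnessLib

/-!
# Nonnegativity of `τ̂_p(k)` (Aizenman–Newman 1984, Lemma 3.3; Heydenreich–van der Hofstad 2017,
# Lemma 5.3)

Topic `Literature/Probability/Percolation`. For nearest-neighbour bond percolation on `ℤ^d`
(`d ≥ 2`) and `p < p_c`, the Fourier transform of the two-point function is nonnegative:
`τ̂_p(k) = Σ_x cos(k·x) τ_p(0,x) ≥ 0` for every `k` (`tauHat_nonneg`). Printed statement
(HvdH Lemma 5.3): "Let `p ∈ [0,1]` be such that `χ(p) < ∞`. Then, for every `k ∈ (-π,π]^d`,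
`τ̂_p(k) ≥ 0`." Printed proof: `τ_p(x,y)` "is of positive type", since
`Σ_{x,y} f̄(x) τ_p(x,y) f(y) = E_p[Σ_𝒞 |Σ_{x∈𝒞} f(x)|²] ≥ 0` (5.1.3)–(5.1.4), "The claim now
follows from Bochner's theorem". We vendor the hypothesis as `p < p_c` (where `χ(p) < ∞`,
`summable_tau_of_lt_criticalProb`) and replace the appeal to Bochner's theorem by the Fejér
average it amounts to here:

* `sum_sum_ite_reachable_nonneg` — for any graph `G`, finite `Λ` and real `a, b`,
  `Σ_{x,y∈Λ} 𝟙{x ↔ y} (a_x a_y + b_x b_y) = Σ_𝒞 [(Σ_{𝒞∩Λ} a)² + (Σ_{𝒞∩Λ} b)²] ≥ 0` (grouping by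
  connected component);
* `sum_sum_cos_mul_tau_nonneg` — taking `a = cos(k·)`, `b = sin(k·)` and expectations,
  `Σ_{x,y∈Λ} cos(k·(y-x)) τ_p(x,y) ≥ 0` ((5.1.3)–(5.1.4) with `f(x) = e^{ik·x} 𝟙_Λ(x)`);
* `sum_sum_eq_tsum_mul_card` — `Σ_{x,y∈Λ} g(y-x) = Σ_z g(z) #{x ∈ Λ : x + z ∈ Λ}` for summable `g`;
* `tendsto_card_filter_add_mem_box_div` — `#{x ∈ Λ_n : x + z ∈ Λ_n}/|Λ_n| → 1`;
* `tauHat_nonneg` — dividing by `|Λ_n|` and letting `n → ∞` (dominated convergence),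
  `0 ≤ |Λ_n|⁻¹ Σ_{x,y∈Λ_n} cos(k·(y-x)) τ_p(x,y) → τ̂_p(k)`.

Wanted by the lace-expansion bootstrap (`Literature/Barriers/CriticalPhenomena/GaussianDominationRoute*.lean`,
HvdH Lemma 8.12: positivity of `Â = 1/(1 - â) = τ̂_p/(1 + Π̂_p)`).

## References

* M. Heydenreich, R. van der Hofstad, *Progress in High-Dimensional Percolation and Random
  Graphs* (Springer 2017), Lemma 5.3 and (5.1.3)–(5.1.4).
* M. Aizenman, C. M. Newman, *Tree graph inequalities and critical behavior in percolation
  models*, J. Stat. Phys. 36 (1984) 107–143, Lemma 3.3.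
-/

noncomputable section

namespace Literature.Probability.Percolation

open _root_.MeasureTheory _root_.Filter _root_.Topology
open Literature.Probability.LatticeModels Literature.Barriers.CriticalPhenomena
open scoped BigOperators

variable {d : ℕ}

/-! ### Positive type, pointwise: grouping by connected components -/

/-- **The connectivity indicator is of positive type** (pointwise in the configuration): for a
graph `G`, a finite vertex set `Λ` and real weights `a, b`,
`Σ_{x,y∈Λ} 𝟙{x ↔ y} (a_x a_y + b_x b_y) = Σ_𝒞 [(Σ_{x∈𝒞∩Λ} a_x)² + (Σ_{x∈𝒞∩Λ} b_x)²] ≥ 0`, the sum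
over connected components `𝒞`. [cite: HeydenreichVanDerHofstad2017, (5.1.4)] -/
theorem sum_sum_ite_reachable_nonneg {V : Type*} (G : SimpleGraph V) (Λ : Finset V) (a b : V → ℝ)
    [DecidableRel G.Reachable] :
    0 ≤ ∑ x ∈ Λ, ∑ y ∈ Λ, (if G.Reachable x y then a x * a y + b x * b y else 0) := by
  classical
  set c : V → G.ConnectedComponent := G.connectedComponentMk with hc
  have hiff : ∀ x y, G.Reachable x y ↔ c x = c y := fun x y =>
    SimpleGraph.ConnectedComponent.eq.symm
  simp_rw [hiff]
  rw [← Finset.sum_fiberwise_of_maps_to (s := Λ) (t := Λ.image c) (g := c)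
    (fun x hx => Finset.mem_image_of_mem c hx)
    (f := fun x => ∑ y ∈ Λ, if c x = c y then a x * a y + b x * b y else 0)]
  refine Finset.sum_nonneg fun r _ => ?_
  have inner : ∀ x ∈ Λ.filter (fun x => c x = r),
      (∑ y ∈ Λ, if c x = c y then a x * a y + b x * b y else 0)
        = ∑ y ∈ Λ.filter (fun y => c y = r), (a x * a y + b x * b y) := by
    intro x hx
    rw [Finset.mem_filter] at hx
    rw [Finset.sum_filter]
    refine Finset.sum_congr rfl fun y _ => ?_
    rw [hx.2]
    by_cases h : c y = r
    · rw [if_pos h, if_pos h.symm]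
    · rw [if_neg h, if_neg (Ne.symm h)]
  rw [Finset.sum_congr rfl inner]
  have hsq : ∑ x ∈ Λ.filter (fun x => c x = r), ∑ y ∈ Λ.filter (fun y => c y = r),
      (a x * a y + b x * b y)
      = (∑ x ∈ Λ.filter (fun x => c x = r), a x) ^ 2 +
        (∑ x ∈ Λ.filter (fun x => c x = r), b x) ^ 2 := by
    rw [sq, sq, Finset.sum_mul_sum, Finset.sum_mul_sum, ← Finset.sum_add_distrib]
    refine Finset.sum_congr rfl fun x _ => ?_
    rw [← Finset.sum_add_distrib]
  rw [hsq]
  positivity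

/-- **(5.1.3)–(5.1.4) with `f = e^{ik·} 𝟙_Λ`**: for every finite `Λ ⊆ ℤ^d`, `p` and `k`,
`Σ_{x,y∈Λ} cos(k·(y-x)) τ_p(x,y) = E_p[Σ_{x,y∈Λ} 𝟙{x ↔ y}(cos(k·x)cos(k·y) + sin(k·x)sin(k·y))] ≥ 0`.
[cite: HeydenreichVanDerHofstad2017, Lemma 5.3 (proof, (5.1.3)–(5.1.4))] [cite: AizenmanNewman1984, Lemma 3.3] -/
theorem sum_sum_cos_mul_tau_nonneg (p : unitInterval) (Λ : Finset (Site d)) (k : Fin d → ℝ) :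
    0 ≤ ∑ x ∈ Λ, ∑ y ∈ Λ, Real.cos (kdot k (y - x)) * tau d p x y := by
  classical
  set F : Site d → Site d → ℝ := fun x y =>
    Real.cos (kdot k x) * Real.cos (kdot k y) + Real.sin (kdot k x) * Real.sin (kdot k y) with hF
  set Q : BondConfig (Site d) → ℝ := fun ω => ∑ x ∈ Λ, ∑ y ∈ Λ,
    (openConn x y : Set (BondConfig (Site d))).indicator (fun _ => F x y) ω with hQ
  have hQ0 : ∀ ω, 0 ≤ Q ω := by
    intro ω
    have h := sum_sum_ite_reachable_nonneg (openGraph ω) Λ (fun x => Real.cos (kdot k x))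
      (fun x => Real.sin (kdot k x))
    rw [hQ]
    convert h using 2 with x _
    refine Finset.sum_congr rfl fun y _ => ?_
    simp only [Set.indicator_apply, openConn, Set.mem_setOf_eq, hF]
  have hint : ∫ ω, Q ω ∂(bondPercolation (zdGraph d) p) =
      ∑ x ∈ Λ, ∑ y ∈ Λ, Real.cos (kdot k (y - x)) * tau d p x y := by
    rw [hQ]
    rw [integral_finsetSum _ (fun x _ => integrable_finsetSum _ (fun y _ =>
      (integrable_const (F x y)).indicator (measurableSet_openConn_holds x y)))]
    refine Finset.sum_congr rfl fun x _ => ?_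
    rw [integral_finsetSum _ (fun y _ =>
      (integrable_const (F x y)).indicator (measurableSet_openConn_holds x y))]
    refine Finset.sum_congr rfl fun y _ => ?_
    rw [integral_indicator_const _ (measurableSet_openConn_holds x y), smul_eq_mul, tau_def]
    have e : kdot k (y - x) = kdot k y - kdot k x := by
      rw [sub_eq_add_neg, kdot_add, kdot_neg, ← sub_eq_add_neg]
    rw [e, Real.cos_sub, hF]
    ring
  rw [← hint]
  exact integral_nonneg hQ0

/-! ### The Fejér average -/

/-- `Σ_{x,y∈Λ} g(y-x) = Σ_z g(z) · #{x ∈ Λ : x + z ∈ Λ}` for summable `g`. [folklore] -/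
theorem sum_sum_eq_tsum_mul_card (Λ : Finset (Site d)) {g : Site d → ℝ} (hg : Summable g) :
    ∑ x ∈ Λ, ∑ y ∈ Λ, g (y - x) =
      ∑' z, g z * ((Λ.filter (fun x => x + z ∈ Λ)).card : ℝ) := by
  classical
  have h1 : ∀ x ∈ Λ, ∑ y ∈ Λ, g (y - x) = ∑' z, g z * (if x + z ∈ Λ then 1 else 0) := by
    intro x _
    rw [← Finset.sum_image (s := Λ) (g := fun y => y - x) (f := g)
      (fun y _ y' _ h => sub_left_injective h), sum_eq_tsum_indicator]
    refine tsum_congr fun z => ?_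
    simp only [Set.indicator_apply, Finset.coe_image, Set.mem_image, Finset.mem_coe]
    by_cases hz : x + z ∈ Λ
    · rw [if_pos ⟨x + z, hz, add_sub_cancel_left x z⟩, if_pos hz, mul_one]
    · rw [if_neg, if_neg hz, mul_zero]
      rintro ⟨y, hy, rfl⟩
      exact hz (by rwa [add_sub_cancel])
  rw [Finset.sum_congr rfl h1, ← Summable.tsum_finsetSum (fun x _ => ?_)]
  · refine tsum_congr fun z => ?_
    rw [← Finset.mul_sum, Finset.sum_boole]
  · refine Summable.of_norm_bounded hg.norm fun z => ?_
    rw [Real.norm_eq_abs, abs_mul, Real.norm_eq_abs]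
    refine mul_le_of_le_one_right (abs_nonneg _) ?_
    split_ifs <;> simp

/-- `#{x ∈ Λ_n : x + z ∈ Λ_n} / |Λ_n| → 1` as `n → ∞`, for each `z ∈ ℤ^d` (`Λ_n = [-n,n]^d`; the
count is at least `|Λ_{n-‖z‖_∞}|`). [folklore] -/
theorem tendsto_card_filter_add_mem_box_div (z : Site d) :
    Tendsto (fun n : ℕ => (((box d n).filter (fun x => x + z ∈ box d n)).card : ℝ) / (box d n).card)
      atTop (𝓝 1) := by
  classical
  set M : ℕ := Finset.univ.sup fun i => (z i).natAbs with hM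
  have hMi : ∀ i, (z i).natAbs ≤ M := fun i =>
    Finset.le_sup (f := fun i => (z i).natAbs) (Finset.mem_univ i)
  have hcard : ∀ n : ℕ, ((box d n).card : ℝ) = (2 * n + 1) ^ d := fun n => by
    rw [card_box]; push_cast; ring
  have hpos : ∀ n : ℕ, (0 : ℝ) < (box d n).card := fun n => by
    rw [hcard]; positivity
  -- upper bound `≤ 1`
  have hup : ∀ n : ℕ, (((box d n).filter (fun x => x + z ∈ box d n)).card : ℝ) / (box d n).card ≤ 1 :=
    fun n => by
      rw [div_le_one (hpos n)]
      exact_mod_cast Finset.card_filter_le _ _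
  -- lower bound `≥ 1 - d (2M/(2n+1))` for `n ≥ M`
  have hlow : ∀ n : ℕ, M ≤ n →
      1 - d * (2 * M / (2 * n + 1)) ≤
        (((box d n).filter (fun x => x + z ∈ box d n)).card : ℝ) / (box d n).card := by
    intro n hn
    have hsub : box d (n - M) ⊆ (box d n).filter (fun x => x + z ∈ box d n) := by
      intro x hx
      rw [mem_box] at hx
      rw [Finset.mem_filter, mem_box, mem_box]
      have hnM : ((n - M : ℕ) : ℤ) = n - M := by push_cast [Nat.cast_sub hn]; ring
      refine ⟨fun i => ?_, fun i => ?_⟩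
      · have h1 := (hx i).1
        have h2 := (hx i).2
        rw [hnM] at h1 h2
        constructor <;> omega
      · have h1 := (hx i).1
        have h2 := (hx i).2
        rw [hnM] at h1 h2
        have hz : |z i| ≤ M := by
          rw [Int.abs_eq_natAbs]; exact_mod_cast hMi i
        have hz' := abs_le.1 hz
        simp only [Pi.add_apply]
        constructor <;> omega
    have hc := Finset.card_le_card hsub
    rw [card_box] at hc
    have hc' : ((2 * (n - M) + 1) ^ d : ℕ) ≤ (((box d n).filter (fun x => x + z ∈ box d n)).card : ℝ) := by
      exact_mod_cast hc
    rw [le_div_iff₀ (hpos n), hcard]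
    refine le_trans ?_ hc'
    have hnM : ((n - M : ℕ) : ℝ) = n - M := by rw [Nat.cast_sub hn]
    push_cast
    rw [hnM]
    -- Bernoulli: `(1 - t)^d ≥ 1 - d t` with `1 - t = (2(n-M)+1)/(2n+1)`
    have hn1 : (0 : ℝ) < 2 * n + 1 := by positivity
    have ht : -2 ≤ -(2 * (M : ℝ) / (2 * n + 1)) := by
      rw [neg_le_neg_iff, div_le_iff₀ hn1]
      have : (M : ℝ) ≤ n := by exact_mod_cast hn
      nlinarith
    have hB := one_add_mul_le_pow ht d
    calc (1 - d * (2 * M / (2 * n + 1))) * (2 * n + 1) ^ d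
        = (1 + d * -(2 * (M : ℝ) / (2 * n + 1))) * (2 * n + 1) ^ d := by ring
      _ ≤ (1 + -(2 * (M : ℝ) / (2 * n + 1))) ^ d * (2 * n + 1) ^ d :=
          mul_le_mul_of_nonneg_right hB (by positivity)
      _ = (2 * ((n : ℝ) - M) + 1) ^ d := by
          rw [← mul_pow]
          congr 1
          field_simp
          ring
  -- squeeze
  have hlim : Tendsto (fun n : ℕ => 1 - d * (2 * (M : ℝ) / (2 * n + 1))) atTop (𝓝 1) := by
    have h1 : Tendsto (fun n : ℕ => (2 * (n : ℝ) + 1)) atTop atTop :=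
      (tendsto_natCast_atTop_atTop.const_mul_atTop (by norm_num : (0 : ℝ) < 2)).atTop_add
        tendsto_const_nhds
    have h2 : Tendsto (fun n : ℕ => 2 * (M : ℝ) / (2 * n + 1)) atTop (𝓝 0) :=
      tendsto_const_nhds.div_atTop h1
    have h3 := (h2.const_mul (d : ℝ)).const_sub 1
    simpa using h3
  refine tendsto_of_tendsto_of_tendsto_of_le_of_le' hlim tendsto_const_nhds ?_
    (Eventually.of_forall hup)
  filter_upwards [eventually_ge_atTop M] with n hn
  exact hlow n hn

/-- **Heydenreich–van der Hofstad Lemma 5.3 / Aizenman–Newman Lemma 3.3: `τ̂_p(k) ≥ 0`** for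
`p < p_c` (`d ≥ 2`) and every `k`: `0 ≤ |Λ_n|⁻¹ Σ_{x,y∈Λ_n} cos(k·(y-x)) τ_p(x,y)
= Σ_z cos(k·z) τ_p(0,z) #{x ∈ Λ_n : x+z ∈ Λ_n}/|Λ_n| → τ̂_p(k)` (dominated convergence, the weights
lying in `[0,1]` and tending to `1`). [cite: HeydenreichVanDerHofstad2017, Lemma 5.3]
[cite: AizenmanNewman1984, Lemma 3.3] -/
theorem tauHat_nonneg (hd : 2 ≤ d) (p : unitInterval)
    (hp : (p : ℝ) < criticalProb (zdGraph d) (0 : Site d)) (k : Fin d → ℝ) :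
    0 ≤ tauHat d p k := by
  classical
  have hs := summable_tau_of_lt_criticalProb hd p hp
  set g : Site d → ℝ := fun z => Real.cos (kdot k z) * tau d p 0 z with hg
  have hgs : Summable g := summable_cos_kdot_mul_tau p hs k
  set w : ℕ → Site d → ℝ := fun n z =>
    (((box d n).filter (fun x => x + z ∈ box d n)).card : ℝ) / (box d n).card with hw
  have hw0 : ∀ n z, 0 ≤ w n z := fun n z => by simp only [hw]; positivity
  have hw1 : ∀ n z, w n z ≤ 1 := fun n z => by
    simp only [hw]
    have hpos : (0 : ℝ) < (box d n).card := by
      exact_mod_cast Finset.card_pos.2 ⟨0, by simp [mem_box]⟩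
    rw [div_le_one hpos]
    exact_mod_cast Finset.card_filter_le _ _
  -- the Fejér averages are nonnegative
  have hT : ∀ n : ℕ, 0 ≤ ∑' z, g z * w n z := by
    intro n
    have h0 := sum_sum_cos_mul_tau_nonneg p (box d n) k
    have hpos : (0 : ℝ) < (box d n).card := by
      exact_mod_cast Finset.card_pos.2 ⟨0, by simp [mem_box]⟩
    have e : ∑ x ∈ box d n, ∑ y ∈ box d n, Real.cos (kdot k (y - x)) * tau d p x y =
        ∑' z, g z * (((box d n).filter (fun x => x + z ∈ box d n)).card : ℝ) := by
      have h1 : ∀ x y : Site d, Real.cos (kdot k (y - x)) * tau d p x y = g (y - x) := fun x y => by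
        rw [hg, tau_eq_tau_zero_sub p x y]
      simp_rw [h1]
      exact sum_sum_eq_tsum_mul_card (box d n) hgs
    have e2 : ∑' z, g z * w n z =
        (∑' z, g z * (((box d n).filter (fun x => x + z ∈ box d n)).card : ℝ)) / (box d n).card := by
      rw [← tsum_div_const]
      refine tsum_congr fun z => ?_
      simp only [hw]; ring
    rw [e2, ← e]
    exact div_nonneg h0 hpos.le
  -- and converge to `τ̂_p(k)`
  have hlim : Tendsto (fun n => ∑' z, g z * w n z) atTop (𝓝 (∑' z, g z)) := by
    refine tendsto_tsum_of_dominated_convergence (bound := fun z => tau d p 0 z) hs (fun z => ?_)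
      (Eventually.of_forall fun n z => ?_)
    · have h := (tendsto_card_filter_add_mem_box_div z).const_mul (g z)
      rw [mul_one] at h
      exact h
    · rw [Real.norm_eq_abs, abs_mul, abs_of_nonneg (hw0 n z), hg]
      dsimp only
      rw [abs_mul, abs_of_nonneg (tau_nonneg p 0 z)]
      calc |Real.cos (kdot k z)| * tau d p 0 z * w n z
          ≤ 1 * tau d p 0 z * 1 := by
            refine mul_le_mul (mul_le_mul_of_nonneg_right (Real.abs_cos_le_one _) (tau_nonneg p 0 z))
              (hw1 n z) (hw0 n z) (by rw [one_mul]; exact tau_nonneg p 0 z)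
        _ = tau d p 0 z := by ring
  exact ge_of_tendsto' hlim hT

end Literature.Probability.Percolation

end
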